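import Summits.CriticalPhenomena.PercolationContinuityZ3.Theorems.PercNearOneGluingNoHeavyLowerTailSahiCoSingleton
import Literature.Combinatorics.Sahi2008.UniformCube
import Literature.Combinatorics.Sahi2008.FKG
import Mathlib.Tactic.Linarith
import Mathlib.Tactic.Ring
import HarnessLib

/-!
# `NoHeavyLowerTail` (stmt-CriticalPhenomena-4575) — the half-co-singleton bound HOLDS on the two-equal-slot chain family `(h,h,f)`, `f ≤ h`

Support file, seat `prim-l12-p5` (gen 2), `--supports stmt-CriticalPhenomena-4575`.  No new definitions, no named facts, no sorries.

The half-co-singleton bound HC (P5-REPORT §3h(o); tree `…SahiCoSingleton`, appendix) asserts, for every coordinate `j` of a monotone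
indicator triple, `Z_{[k]−j} := E[E₃ of the one-coin sections at j] ≤ 2·E₃` — the constant `2` being approached on the family
`f₁ = f₂ = h ⊇ f₃ = f` (e.g. `h = (x₀⋯x_{m−1}) ∨ y`, `f = x₀⋯x_{m−1}`).  THIS FILE PROVES HC ON THAT WHOLE FAMILY:

**`coSingletonSum_le_two_mul_sahiE_of_le`**: for `q ∈ [0,1]^ι`, monotone `{0,1}`-valued `f ≤ h` on `ι → Bool` and every `j`,
`coSingletonSum q ![h,h,f] j ≤ 2 · E₃(h,h,f)`.

Proof (P5-REPORT §3h(q)(ii)): with `s = q_j`, `a = E f`, `b = E h`: (1) `E₃(h,h,f) = a(1−b)(2−b)` (`sahiE_three_apply`, `h·h = h`,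
`h·f = f`); (2) `Z_{[k]−j} = s(1−s)·J_j` (`coSingletonSum_eq`) and pointwise `J`-integrand `≤ (2−s)·f(hi)·(1 − h(lo))` (a `{0,1}` case
analysis using `f ≤ h`); (3) HARRIS on the cube of the other coordinates (`ex_mul_ex_le_ex_mul` for the product weight, which is an FKG
weight by `isFKGMeasure_coinWeight`): `E[f(hi)(1 − h(lo))] ≤ E[f(hi)]·E[1 − h(lo)]`; (4) `s·E_v[f(hi j v)] ≤ a` and
`(1−s)·E_v[1 − h(lo j v)] ≤ 1 − b` (the `x_j = 1`, resp. `x_j = 0`, slice of the cube carries weight `s`, resp. `1−s`: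
`mul_sum_hi_le_ex`, `mul_sum_lo_le_ex`); (5) `(2−s)·a(1−b) ≤ 2(2−b)·a(1−b) = 2E₃`.
-/

namespace Summit.CriticalPhenomena.PercolationContinuityZ3.Theorems

namespace SahiCoSingleton

open Finset Literature.Combinatorics.Sahi2008 SahiSubsetChord

variable {ι : Type*} [Fintype ι] [DecidableEq ι]

/-- `hi j v` has `j`-th coordinate `true`. [this file] -/
theorem hi_apply_self (j : ι) (v : {i // i ∈ (univ : Finset ι).erase j} → Bool) : hi j v j = true := by
  unfold hi glue
  rw [dif_neg (fun h => (Finset.mem_erase.mp h).1 rfl)]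

/-- `lo j v` has `j`-th coordinate `false`. [this file] -/
theorem lo_apply_self (j : ι) (v : {i // i ∈ (univ : Finset ι).erase j} → Bool) : lo j v j = false := by
  unfold lo glue
  rw [dif_neg (fun h => (Finset.mem_erase.mp h).1 rfl)]

/-- Off `j`, `hi j v` agrees with `v`. [this file] -/
theorem hi_apply_mem (j : ι) (v : {i // i ∈ (univ : Finset ι).erase j} → Bool) {i : ι}
    (h : i ∈ (univ : Finset ι).erase j) : hi j v i = v ⟨i, h⟩ := by
  unfold hi glue
  rw [dif_pos h]

/-- Off `j`, `lo j v` agrees with `v`. [this file] -/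
theorem lo_apply_mem (j : ι) (v : {i // i ∈ (univ : Finset ι).erase j} → Bool) {i : ι}
    (h : i ∈ (univ : Finset ι).erase j) : lo j v i = v ⟨i, h⟩ := by
  unfold lo glue
  rw [dif_pos h]

/-- `v ↦ hi j v` is monotone. [this file] -/
theorem hi_mono (j : ι) : Monotone (hi j : ({i // i ∈ (univ : Finset ι).erase j} → Bool) → ι → Bool) := by
  intro v v' hvv' i
  unfold hi glue
  split_ifs with h
  · exact hvv' ⟨i, h⟩
  · exact le_rfl

/-- `v ↦ lo j v` is monotone. [this file] -/
theorem lo_mono (j : ι) : Monotone (lo j : ({i // i ∈ (univ : Finset ι).erase j} → Bool) → ι → Bool) := by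
  intro v v' hvv' i
  unfold lo glue
  split_ifs with h
  · exact hvv' ⟨i, h⟩
  · exact le_rfl

/-- `hi j` is injective. [this file] -/
theorem hi_injective (j : ι) : Function.Injective (hi j : ({i // i ∈ (univ : Finset ι).erase j} → Bool) → ι → Bool) := by
  intro v v' hvv'
  funext i
  have h1 := congrArg (fun x => x i.1) hvv'
  simp only [hi_apply_mem j v i.2, hi_apply_mem j v' i.2] at h1
  exact h1

/-- `lo j` is injective. [this file] -/
theorem lo_injective (j : ι) : Function.Injective (lo j : ({i // i ∈ (univ : Finset ι).erase j} → Bool) → ι → Bool) := by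
  intro v v' hvv'
  funext i
  have h1 := congrArg (fun x => x i.1) hvv'
  simp only [lo_apply_mem j v i.2, lo_apply_mem j v' i.2] at h1
  exact h1

/-- The product weight of `hi j v` splits off the factor `q_j`. [this file] -/
theorem prodWeight_hi (q : ι → ℝ) (j : ι) (v : {i // i ∈ (univ : Finset ι).erase j} → Bool) :
    prodWeight q (hi j v) = q j * prodWeight (fun i : {i // i ∈ (univ : Finset ι).erase j} => q i) v := by
  unfold prodWeight
  rw [← Finset.mul_prod_erase (univ : Finset ι) _ (Finset.mem_univ j), hi_apply_self, if_pos rfl]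
  congr 1
  rw [← Finset.prod_coe_sort ((univ : Finset ι).erase j)]
  refine Finset.prod_congr rfl fun i _ => ?_
  rw [hi_apply_mem j v i.2]

/-- The product weight of `lo j v` splits off the factor `1 − q_j`. [this file] -/
theorem prodWeight_lo (q : ι → ℝ) (j : ι) (v : {i // i ∈ (univ : Finset ι).erase j} → Bool) :
    prodWeight q (lo j v) = (1 - q j) * prodWeight (fun i : {i // i ∈ (univ : Finset ι).erase j} => q i) v := by
  unfold prodWeight
  rw [← Finset.mul_prod_erase (univ : Finset ι) _ (Finset.mem_univ j), lo_apply_self]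
  simp only [Bool.false_eq_true, if_false]
  congr 1
  rw [← Finset.prod_coe_sort ((univ : Finset ι).erase j)]
  refine Finset.prod_congr rfl fun i _ => ?_
  rw [lo_apply_mem j v i.2]

/-- The `x_j = 1` slice: `q_j · Σ_v w(v)·g(hi j v) ≤ E g` for `g ≥ 0`. [this file] -/
theorem mul_sum_hi_le_ex (q : ι → ℝ) (hq : ∀ i, 0 ≤ q i ∧ q i ≤ 1) (g : (ι → Bool) → ℝ) (hg : ∀ x, 0 ≤ g x) (j : ι) :
    q j * ∑ v : ({i // i ∈ (univ : Finset ι).erase j} → Bool),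
        prodWeight (fun i : {i // i ∈ (univ : Finset ι).erase j} => q i) v * g (hi j v)
      ≤ ex (prodWeight q) g := by
  unfold ex
  rw [Finset.mul_sum]
  have hre : ∀ v : ({i // i ∈ (univ : Finset ι).erase j} → Bool),
      q j * (prodWeight (fun i : {i // i ∈ (univ : Finset ι).erase j} => q i) v * g (hi j v))
        = prodWeight q (hi j v) * g (hi j v) := fun v => by rw [prodWeight_hi]; ring
  simp only [hre]
  rw [← Finset.sum_image (f := fun x => prodWeight q x * g x) (fun v _ v' _ h => hi_injective j h)]
  exact Finset.sum_le_sum_of_subset_of_nonneg (Finset.subset_univ _)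
    (fun x _ _ => mul_nonneg (prodWeight_nonneg hq x) (hg x))

/-- The `x_j = 0` slice: `(1 − q_j) · Σ_v w(v)·g(lo j v) ≤ E g` for `g ≥ 0`. [this file] -/
theorem mul_sum_lo_le_ex (q : ι → ℝ) (hq : ∀ i, 0 ≤ q i ∧ q i ≤ 1) (g : (ι → Bool) → ℝ) (hg : ∀ x, 0 ≤ g x) (j : ι) :
    (1 - q j) * ∑ v : ({i // i ∈ (univ : Finset ι).erase j} → Bool),
        prodWeight (fun i : {i // i ∈ (univ : Finset ι).erase j} => q i) v * g (lo j v)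
      ≤ ex (prodWeight q) g := by
  unfold ex
  rw [Finset.mul_sum]
  have hre : ∀ v : ({i // i ∈ (univ : Finset ι).erase j} → Bool),
      (1 - q j) * (prodWeight (fun i : {i // i ∈ (univ : Finset ι).erase j} => q i) v * g (lo j v))
        = prodWeight q (lo j v) * g (lo j v) := fun v => by rw [prodWeight_lo]; ring
  simp only [hre]
  rw [← Finset.sum_image (f := fun x => prodWeight q x * g x) (fun v _ v' _ h => lo_injective j h)]
  exact Finset.sum_le_sum_of_subset_of_nonneg (Finset.subset_univ _)
    (fun x _ _ => mul_nonneg (prodWeight_nonneg hq x) (hg x))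

/-- HARRIS on the cube of the other coordinates, in the form used here: for monotone `f, h ≥ 0` with `h ≤ 1`,
`Σ_v w(v)·f(hi v)·(1 − h(lo v)) ≤ (Σ_v w(v) f(hi v))·(Σ_v w(v)(1 − h(lo v)))`. [this file] -/
theorem sum_hi_mul_one_sub_lo_le (q : ι → ℝ) (hq : ∀ i, 0 ≤ q i ∧ q i ≤ 1) (f h : (ι → Bool) → ℝ)
    (hf0 : ∀ x, 0 ≤ f x) (hh0 : ∀ x, 0 ≤ h x) (hfm : Monotone f) (hhm : Monotone h) (j : ι) :
    ∑ v : ({i // i ∈ (univ : Finset ι).erase j} → Bool),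
        prodWeight (fun i : {i // i ∈ (univ : Finset ι).erase j} => q i) v * (f (hi j v) * (1 - h (lo j v)))
      ≤ (∑ v : ({i // i ∈ (univ : Finset ι).erase j} → Bool),
            prodWeight (fun i : {i // i ∈ (univ : Finset ι).erase j} => q i) v * f (hi j v)) *
        (∑ v : ({i // i ∈ (univ : Finset ι).erase j} → Bool),
            prodWeight (fun i : {i // i ∈ (univ : Finset ι).erase j} => q i) v * (1 - h (lo j v))) := by
  set w : ({i // i ∈ (univ : Finset ι).erase j} → Bool) → ℝ :=
    prodWeight (fun i : {i // i ∈ (univ : Finset ι).erase j} => q i) with hw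
  have hFKG : IsFKGMeasure w := isFKGMeasure_coinWeight (fun i => hq i)
  have hu : Monotone (fun v => f (hi j v)) := fun v v' hvv' => hfm (hi_mono j hvv')
  have hv : Monotone (fun v => h (lo j v)) := fun v v' hvv' => hhm (lo_mono j hvv')
  have key := ex_mul_ex_le_ex_mul hFKG (f := fun v => f (hi j v)) (g := fun v => h (lo j v))
    (fun v => hf0 _) (fun v => hh0 _) hu hv
  have hsum1 : ∑ v, w v = 1 := sum_coinWeight _
  unfold ex at key
  have e1 : ∑ v, w v * (f (hi j v) * (1 - h (lo j v)))
      = ∑ v, w v * f (hi j v) - ∑ v, w v * (f (hi j v) * h (lo j v)) := by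
    rw [← Finset.sum_sub_distrib]; refine Finset.sum_congr rfl fun v _ => ?_; ring
  have e2 : ∑ v, w v * (1 - h (lo j v)) = 1 - ∑ v, w v * h (lo j v) := by
    rw [show (1 : ℝ) - ∑ v, w v * h (lo j v) = ∑ v, w v - ∑ v, w v * h (lo j v) by rw [hsum1],
      ← Finset.sum_sub_distrib]
    refine Finset.sum_congr rfl fun v _ => ?_; ring
  rw [e1, e2]
  have hA : 0 ≤ ∑ v, w v * f (hi j v) :=
    Finset.sum_nonneg fun v _ => mul_nonneg
      (prodWeight_nonneg (q := fun i : {i // i ∈ (univ : Finset ι).erase j} => q i) (fun i => hq i) v) (hf0 _)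
  have key' : (∑ v, w v * f (hi j v)) * (∑ v, w v * h (lo j v)) ≤ ∑ v, w v * (f (hi j v) * h (lo j v)) := by
    simpa [Pi.mul_apply] using key
  nlinarith [key', hA]

/-- **HC on the family `(h,h,f)` with `f ≤ h`** (it contains the configurations where the constant `2` of HC is approached): for every
coordinate `j`, `E[E₃ of the one-coin sections of (h,h,f) at j] ≤ 2·E₃(h,h,f)`. [this file] -/
theorem coSingletonSum_le_two_mul_sahiE_of_le (q : ι → ℝ) (hq : ∀ i, 0 ≤ q i ∧ q i ≤ 1) (h f : (ι → Bool) → ℝ)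
    (hh01 : ∀ x, h x = 0 ∨ h x = 1) (hf01 : ∀ x, f x = 0 ∨ f x = 1) (hhm : Monotone h) (hfm : Monotone f)
    (hfh : ∀ x, f x ≤ h x) (j : ι) :
    coSingletonSum q ![h, h, f] j ≤ 2 * sahiE (prodWeight q) 3 ![h, h, f] := by
  -- bookkeeping facts
  have hind : ∀ a x, (![h, h, f] : Fin 3 → (ι → Bool) → ℝ) a x = 0 ∨ (![h, h, f] : Fin 3 → (ι → Bool) → ℝ) a x = 1 := by
    intro a x; fin_cases a
    · exact hh01 x
    · exact hh01 x
    · exact hf01 x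
  have hmono : ∀ a, Monotone ((![h, h, f] : Fin 3 → (ι → Bool) → ℝ) a) := by
    intro a; fin_cases a
    · exact hhm
    · exact hhm
    · exact hfm
  have hf0 : ∀ x, 0 ≤ f x := fun x => by rcases hf01 x with e | e <;> simp [e]
  have hh0 : ∀ x, 0 ≤ h x := fun x => by rcases hh01 x with e | e <;> simp [e]
  have hh1 : ∀ x, h x ≤ 1 := fun x => by rcases hh01 x with e | e <;> simp [e]
  set s := q j with hs
  have hs0 : 0 ≤ s := (hq j).1
  have hs1 : s ≤ 1 := (hq j).2
  set w : ({i // i ∈ (univ : Finset ι).erase j} → Bool) → ℝ :=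
    prodWeight (fun i : {i // i ∈ (univ : Finset ι).erase j} => q i) with hw
  have hw0 : ∀ v, 0 ≤ w v := fun v =>
    prodWeight_nonneg (q := fun i : {i // i ∈ (univ : Finset ι).erase j} => q i) (fun i => hq i) v
  -- (1) E₃(h,h,f) = 2a + a b² − 3ab with a = E f, b = E h
  set a := ex (prodWeight q) f with ha
  set b := ex (prodWeight q) h with hb
  have hhf : h * f = f := by
    funext x; simp only [Pi.mul_apply]
    rcases hh01 x with e | e
    · have : f x = 0 := le_antisymm (by rw [← e]; exact hfh x) (hf0 x)
      rw [e, this]; ring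
    · rw [e]; ring
  have hhh2 : h * h = h := by
    funext x; simp only [Pi.mul_apply]
    rcases hh01 x with e | e <;> rw [e] <;> ring
  have hE3 : sahiE (prodWeight q) 3 ![h, h, f] = 2 * a + a * b ^ 2 - 3 * a * b := by
    rw [sahiE_three_apply]
    simp only [Matrix.cons_val_zero, Matrix.cons_val_one, Matrix.head_cons, Matrix.cons_val_two, Matrix.tail_cons,
      hhf, hhh2]
    ring
  have ha0 : 0 ≤ a := ex_nonneg (fun x => prodWeight_nonneg hq x) hf0
  have hb1 : b ≤ 1 := by
    have hsum : ∑ x, prodWeight q x = 1 := sum_coinWeight q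
    have := ex_mono (μ := prodWeight q) (fun x => prodWeight_nonneg hq x) hh1
    rwa [ex_const hsum] at this
  -- (2) Z = s(1−s)·J and the pointwise bound on the J-integrand
  rw [coSingletonSum_eq q _ hind hmono j]
  have hJ : jointPivotality q ![h, h, f] j ≤ (2 - s) * ∑ v, w v * (f (hi j v) * (1 - h (lo j v))) := by
    unfold jointPivotality
    rw [Finset.mul_sum]
    refine Finset.sum_le_sum fun v _ => ?_
    simp only [Matrix.cons_val_zero, Matrix.cons_val_one, Matrix.head_cons, Matrix.cons_val_two, Matrix.tail_cons]
    have hw0v := hw0 v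
    -- case analysis on the four {0,1} values, constrained by monotonicity and f ≤ h
    have hlohi : lo j v ≤ hi j v := by
      intro i; unfold lo hi glue; split_ifs
      · exact le_rfl
      · exact Bool.false_le _
    have m_h : h (lo j v) ≤ h (hi j v) := hhm hlohi
    have m_f : f (lo j v) ≤ f (hi j v) := hfm hlohi
    have c_lo : f (lo j v) ≤ h (lo j v) := hfh _
    have c_hi : f (hi j v) ≤ h (hi j v) := hfh _
    have h2s : 0 ≤ 2 - s := by linarith
    rcases hh01 (lo j v) with h0 | h0 <;> rcases hh01 (hi j v) with h1 | h1 <;>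
      rcases hf01 (lo j v) with f0 | f0 <;> rcases hf01 (hi j v) with f1 | f1 <;>
      simp only [h0, h1, f0, f1] at m_h m_f c_lo c_hi ⊢ <;>
      nlinarith [hw0v, h2s]
  -- (3) Harris, (4) slices
  have hH := sum_hi_mul_one_sub_lo_le q hq f h hf0 hh0 hfm hhm j
  have hA : s * ∑ v, w v * f (hi j v) ≤ a := mul_sum_hi_le_ex q hq f hf0 j
  have hB : (1 - s) * ∑ v, w v * (1 - h (lo j v)) ≤ 1 - b := by
    have := mul_sum_lo_le_ex q hq (fun x => 1 - h x) (fun x => by linarith [hh1 x]) j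
    have e : ex (prodWeight q) (fun x => 1 - h x) = 1 - b := by
      unfold ex
      rw [show (1 : ℝ) - b = ∑ x, prodWeight q x - ∑ x, prodWeight q x * h x by
        rw [show ∑ x, prodWeight q x = 1 from sum_coinWeight q]; rfl, ← Finset.sum_sub_distrib]
      refine Finset.sum_congr rfl fun x _ => ?_; ring
    rw [e] at this; exact this
  have hX0 : 0 ≤ ∑ v, w v * f (hi j v) := Finset.sum_nonneg fun v _ => mul_nonneg (hw0 v) (hf0 _)
  have hY0 : 0 ≤ ∑ v, w v * (1 - h (lo j v)) :=
    Finset.sum_nonneg fun v _ => mul_nonneg (hw0 v) (by linarith [hh1 (lo j v)])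
  have hJ0 : 0 ≤ ∑ v, w v * (f (hi j v) * (1 - h (lo j v))) :=
    Finset.sum_nonneg fun v _ => mul_nonneg (hw0 v) (mul_nonneg (hf0 _) (by linarith [hh1 (lo j v)]))
  -- (5) assemble: s(1−s)J ≤ s(1−s)(2−s)·E[..] ≤ (2−s)·(sX)((1−s)Y) ≤ (2−s)·a·(1−b) ≤ 2·E₃
  rw [hE3]
  have hss : 0 ≤ s * (1 - s) := mul_nonneg hs0 (by linarith)
  have h2s : 0 ≤ 2 - s := by linarith
  have step1 : s * (1 - s) * jointPivotality q ![h, h, f] j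
      ≤ s * (1 - s) * ((2 - s) * ∑ v, w v * (f (hi j v) * (1 - h (lo j v)))) :=
    mul_le_mul_of_nonneg_left hJ hss
  have step2 : s * (1 - s) * ((2 - s) * ∑ v, w v * (f (hi j v) * (1 - h (lo j v))))
      ≤ (2 - s) * ((s * ∑ v, w v * f (hi j v)) * ((1 - s) * ∑ v, w v * (1 - h (lo j v)))) := by
    have := mul_le_mul_of_nonneg_left hH hss
    nlinarith [this, h2s, hss, hJ0]
  have step3 : (s * ∑ v, w v * f (hi j v)) * ((1 - s) * ∑ v, w v * (1 - h (lo j v))) ≤ a * (1 - b) :=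
    mul_le_mul hA hB (mul_nonneg (by linarith) hY0) ha0
  have hb1' : 0 ≤ 1 - b := by linarith
  have step4 : (2 - s) * (a * (1 - b)) ≤ 2 * (2 * a + a * b ^ 2 - 3 * a * b) := by
    have e : 2 * (2 * a + a * b ^ 2 - 3 * a * b) = (2 * (2 - b)) * (a * (1 - b)) := by ring
    rw [e]
    exact mul_le_mul_of_nonneg_right (by linarith) (mul_nonneg ha0 hb1')
  calc s * (1 - s) * jointPivotality q ![h, h, f] j
      ≤ s * (1 - s) * ((2 - s) * ∑ v, w v * (f (hi j v) * (1 - h (lo j v)))) := step1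
    _ ≤ (2 - s) * ((s * ∑ v, w v * f (hi j v)) * ((1 - s) * ∑ v, w v * (1 - h (lo j v)))) := step2
    _ ≤ (2 - s) * (a * (1 - b)) := mul_le_mul_of_nonneg_left step3 h2s
    _ ≤ 2 * (2 * a + a * b ^ 2 - 3 * a * b) := step4

end SahiCoSingleton

end Summit.CriticalPhenomena.PercolationContinuityZ3.Theorems
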